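import Summits.KontsevichZagierPeriods.KontsevichZagierPeriods.Theorems.FermatIsogenyBetaLinearSectorStubSectorPathsAux
import HarnessLib

/-!
# `BetaLinearSector` (stmt-KontsevichZagierPeriods-3897), line `fermat-sector-transport` — stub
# `stub_sectorPaths` (P: the seven auxiliary sector paths on the Fermat curve)

On the affine Fermat curve `F_N = {x^N + y^N = 1}` (`N ≥ 3`) let `γ = γ_N`,
`γ(t) = Q(t)^{−1/N}(1−t, t)`, `Q = (1−t)^N + t^N`, be the radial real arc from `P = (1,0)` to
`O = (0,1)` (landed, `stub_fermatSymbolData`), `ε = e^{iπ/N}`, `ε̄ = e^{−iπ/N}`,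
`Y(z) = exp(−iπ/(2N)) (i(1 − z^N))^{1/N}` the sector chart and `x_f(t) = (2−t)^{1/N} e^{iπt/N}` the
frontier.  We construct, as `CurvePath`s on `F_N` (i.e. `C¹` on `[0,1]`, on the curve, with algebraic
end points) whose `toFun` are the displayed formulas, the seven paths

* `e₂(t) = g₂⁻¹(γ(t/2)) = (1/γ_x, ε̄ γ_y/γ_x)(t/2)` from `P` to `B″ = (2^{1/N}, ε̄)`,
* `f(t) = (x_f(t), Y(x_f(t)))` from `B″` to `C″ = (ε, 2^{1/N})`,
* `e₃(t) = g₃⁻¹(γ((1+t)/2)) = (ε γ_x/γ_y, 1/γ_y)((1+t)/2)` from `C″` to `O`,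
* `d₃(t) = (ε̄ γ_y/γ_x, 1/γ_x)(t/2)` from `O` to `(ε̄, 2^{1/N})`,
* `fI(t) = g₂(f(t)) = (1/x_f, ε Y(x_f)/x_f)` from `A = γ(1/2) = (2^{−1/N}, 2^{−1/N})` to `(ε̄, 2^{1/N})`,
* `γ₁(t) = γ(t/2)`, `γ₂(t) = γ((1+t)/2)`,

together with the seven junction equalities.  Smoothness: `γ` is `C¹` on `[0,1]` and its
coordinates do not vanish where they are inverted (`γ_x > 0` on `[0,1/2]`, `γ_y > 0` on `[1/2,1]`);
`x_f` is smooth and `Y ∘ x_f` is `C¹` because the base `i(1 − x_f^N)` stays in the slit plane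
(file `…StubSectorPathsAux`).  Membership: `(1/x)^N + (η y/x)^N = 1` for `η^N = −1`, and
`Y(z)^N = 1 − z^N`.  End points: `γ(0) = (1,0)`, `γ(1) = (0,1)`, `γ(1/2) = (2^{−1/N}, 2^{−1/N})`,
`x_f(0) = 2^{1/N}`, `x_f(1) = ε`, `Y(2^{1/N}) = ε̄`, `Y(ε) = 2^{1/N}`.

References: B. Gross, *On the periods of abelian integrals and a formula of Chowla and Selberg*
(1978), §1 (with Rohrlich's appendix); A. Huber, G. Wüstholz, *Transcendence and Linear Relations of
1-Periods* (2022), §3.3.1.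
-/

noncomputable section

open scoped BigOperators unitInterval
open MeasureTheory Set MvPolynomial
open Literature.NumberTheory.Transcendental Literature.NumberTheory.Transcendental.CurvePeriods

namespace Summit.KontsevichZagierPeriods.FermatIsogeny.BetaLinearSector

/-- SECTOR STUB P (the seven sector paths exist as `C¹` paths with algebraic end points on `F_N`,
with the junction equalities). Given the radial arc `γ = γ_N`: `e₂ = g₂⁻¹∘γ(t/2)` (real branch
`x ∈ [1, 2^{1/N}]`, from `P` to `B″ = (2^{1/N}, ε̄)`), the frontier `f = Φ ∘ x_f` (from `B″` to
`C″ = (ε, 2^{1/N})`), `e₃ = g₃⁻¹∘γ((1+t)/2)` (the ray `arg x = π/N`, from `C″` to `O`), and in the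
chart at infinity `d₃ = (ε̄γ_y/γ_x, 1/γ_x)(t/2)` (from `O` to `g₂(C″) = (ε̄, 2^{1/N})`) and
`fI = g₂ ∘ f` (from `A = γ(1/2)` to `g₂(C″)`), plus the halves `γ₁ = γ(t/2)`, `γ₂ = γ((1+t)/2)`.
All coordinates are quotients of the (nonvanishing) coordinates of `γ`, or the explicit `x_f`,
`Y(x_f)` (principal power of a base in the slit plane). [cite: Gross1978, §1] -/
theorem stub_sectorPaths : ∀ (N : ℕ), 3 ≤ N →
    ∀ γ : CurvePath (⟨2, 1, ![X 0 ^ N + X 1 ^ N - 1]⟩ : CurveData),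
    (∀ t : ℝ, γ.toFun t = ![(((1 - t) * ((1 - t) ^ N + t ^ N) ^ (-(1:ℝ) / N) : ℝ) : ℂ),
      ((t * ((1 - t) ^ N + t ^ N) ^ (-(1:ℝ) / N) : ℝ) : ℂ)]) →
    ∃ (e₂ f e₃ d₃ f' γ₁ γ₂ : CurvePath (⟨2, 1, ![X 0 ^ N + X 1 ^ N - 1]⟩ : CurveData)),
      (∀ t : ℝ, e₂.toFun t = ![(γ.toFun (t / 2) 0)⁻¹,
        Complex.exp (-(↑Real.pi * Complex.I / (N : ℂ))) * γ.toFun (t / 2) 1 / γ.toFun (t / 2) 0]) ∧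
      (∀ t : ℝ, f.toFun t = ![((((2:ℝ) - t) ^ ((N:ℝ)⁻¹) : ℝ) : ℂ) * Complex.exp (↑Real.pi * Complex.I * (t : ℂ) / (N : ℂ)),
        Complex.exp (-(↑Real.pi * Complex.I / (2 * (N : ℂ)))) *
          (Complex.I * (1 - (((((2:ℝ) - t) ^ ((N:ℝ)⁻¹) : ℝ) : ℂ) *
            Complex.exp (↑Real.pi * Complex.I * (t : ℂ) / (N : ℂ))) ^ N)) ^ ((N : ℂ)⁻¹)]) ∧
      (∀ t : ℝ, e₃.toFun t = ![Complex.exp (↑Real.pi * Complex.I / (N : ℂ)) * γ.toFun ((1 + t) / 2) 0 / γ.toFun ((1 + t) / 2) 1,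
        (γ.toFun ((1 + t) / 2) 1)⁻¹]) ∧
      (∀ t : ℝ, d₃.toFun t = ![Complex.exp (-(↑Real.pi * Complex.I / (N : ℂ))) * γ.toFun (t / 2) 1 / γ.toFun (t / 2) 0,
        (γ.toFun (t / 2) 0)⁻¹]) ∧
      (∀ t : ℝ, f'.toFun t = ![(((((2:ℝ) - t) ^ ((N:ℝ)⁻¹) : ℝ) : ℂ) * Complex.exp (↑Real.pi * Complex.I * (t : ℂ) / (N : ℂ)))⁻¹,
        Complex.exp (↑Real.pi * Complex.I / (N : ℂ)) *
          (Complex.exp (-(↑Real.pi * Complex.I / (2 * (N : ℂ)))) *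
            (Complex.I * (1 - (((((2:ℝ) - t) ^ ((N:ℝ)⁻¹) : ℝ) : ℂ) *
              Complex.exp (↑Real.pi * Complex.I * (t : ℂ) / (N : ℂ))) ^ N)) ^ ((N : ℂ)⁻¹)) /
          (((((2:ℝ) - t) ^ ((N:ℝ)⁻¹) : ℝ) : ℂ) * Complex.exp (↑Real.pi * Complex.I * (t : ℂ) / (N : ℂ)))]) ∧
      (∀ t : ℝ, γ₁.toFun t = γ.toFun (t / 2)) ∧ (∀ t : ℝ, γ₂.toFun t = γ.toFun ((1 + t) / 2)) ∧
      e₂.toFun 0 = γ.toFun 0 ∧ e₂.toFun 1 = f.toFun 0 ∧ f.toFun 1 = e₃.toFun 0 ∧ e₃.toFun 1 = γ.toFun 1 ∧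
      d₃.toFun 0 = γ.toFun 1 ∧ d₃.toFun 1 = f'.toFun 1 ∧ f'.toFun 0 = γ.toFun (1 / 2) := by
  intro N hN γ hγ
  have hN0 : N ≠ 0 := by omega
  have hN1 : 1 ≤ N := by omega
  /- the algebraic constants `ρ = 2^{1/N}`, `ε`, `ε̄` -/
  have hρ : ((((2:ℝ) ^ ((N:ℝ)⁻¹) : ℝ) : ℂ)) ≠ 0 :=
    Complex.ofReal_ne_zero.2 (Real.rpow_pos_of_pos two_pos _).ne'
  have hε : Complex.exp (↑Real.pi * Complex.I / (N : ℂ)) ≠ 0 := Complex.exp_ne_zero _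
  have hρa := sectorPaths_algebraic_root hN0
  have hεa := sectorPaths_algebraic_eps hN0
  have hε'a := sectorPaths_algebraic_epsBar hN0
  /- values of `γ` at `0`, `1`, `1/2`; nonvanishing of its coordinates; `γ ⊂ F_N` -/
  have hγ0 : γ.toFun 0 = ![(1:ℂ), 0] := by
    rw [hγ]
    simp [hN0]
  have hγ1 : γ.toFun 1 = ![(0:ℂ), 1] := by
    rw [hγ]
    simp [hN0]
  have hγh : γ.toFun (1 / 2) =
      ![((((2:ℝ) ^ ((N:ℝ)⁻¹) : ℝ) : ℂ))⁻¹, ((((2:ℝ) ^ ((N:ℝ)⁻¹) : ℝ) : ℂ))⁻¹] := by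
    rw [hγ, show (1:ℝ) - 1 / 2 = 1 / 2 by norm_num, sectorPaths_arc_half hN1, Complex.ofReal_inv]
  have hA : ∀ u : ℝ, u < 1 → γ.toFun u 0 ≠ 0 := fun u hu => by
    rw [hγ]
    exact Complex.ofReal_ne_zero.2 (sectorPaths_arcA_pos hN1 hu).ne'
  have hB : ∀ u : ℝ, 0 < u → γ.toFun u 1 ≠ 0 := fun u hu => by
    rw [hγ]
    exact Complex.ofReal_ne_zero.2 (sectorPaths_arcB_pos hN1 hu).ne'
  have hne1 : ∀ t ∈ Set.Icc (0:ℝ) 1, γ.toFun (t / 2) 0 ≠ 0 := fun t ht => hA _ (by linarith [ht.2])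
  have hne2 : ∀ t ∈ Set.Icc (0:ℝ) 1, γ.toFun ((1 + t) / 2) 1 ≠ 0 := fun t ht =>
    hB _ (by linarith [ht.1])
  have hmem : ∀ u ∈ Set.Icc (0:ℝ) 1, γ.toFun u 0 ^ N + γ.toFun u 1 ^ N = 1 := fun u hu =>
    (mem_points_fermat_iff N _).1 (γ.mem_points u hu)
  /- `t ↦ γ(t/2)` and `t ↦ γ((1+t)/2)` are `C¹` on `[0,1]` -/
  have hI1 : Set.MapsTo (fun t : ℝ => t / 2) (Set.Icc (0:ℝ) 1) (Set.Icc (0:ℝ) 1) := fun t ht => by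
    simp only [Set.mem_Icc] at ht ⊢
    constructor <;> linarith
  have hI2 : Set.MapsTo (fun t : ℝ => (1 + t) / 2) (Set.Icc (0:ℝ) 1) (Set.Icc (0:ℝ) 1) :=
    fun t ht => by
    simp only [Set.mem_Icc] at ht ⊢
    constructor <;> linarith
  have h2 : ContDiff ℝ 1 (fun t : ℝ => t / 2) := contDiff_id.div_const 2
  have h3 : ContDiff ℝ 1 (fun t : ℝ => (1 + t) / 2) := (contDiff_const.add contDiff_id).div_const 2
  have hG1 : ContDiffOn ℝ 1 (fun t : ℝ => γ.toFun (t / 2)) (Set.Icc 0 1) :=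
    γ.contDiffOn.comp h2.contDiffOn hI1
  have hG2 : ContDiffOn ℝ 1 (fun t : ℝ => γ.toFun ((1 + t) / 2)) (Set.Icc 0 1) :=
    γ.contDiffOn.comp h3.contDiffOn hI2
  have hG1_0 : ContDiffOn ℝ 1 (fun t : ℝ => γ.toFun (t / 2) 0) (Set.Icc 0 1) := contDiffOn_pi.1 hG1 0
  have hG1_1 : ContDiffOn ℝ 1 (fun t : ℝ => γ.toFun (t / 2) 1) (Set.Icc 0 1) := contDiffOn_pi.1 hG1 1
  have hG2_0 : ContDiffOn ℝ 1 (fun t : ℝ => γ.toFun ((1 + t) / 2) 0) (Set.Icc 0 1) :=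
    contDiffOn_pi.1 hG2 0
  have hG2_1 : ContDiffOn ℝ 1 (fun t : ℝ => γ.toFun ((1 + t) / 2) 1) (Set.Icc 0 1) :=
    contDiffOn_pi.1 hG2 1
  /- the frontier `x_f` and `Y ∘ x_f` are `C¹` on `[0,1]`, `x_f ≠ 0` -/
  have hxf : ContDiffOn ℝ 1 (fun t : ℝ => ((((2:ℝ) - t) ^ ((N:ℝ)⁻¹) : ℝ) : ℂ) *
      Complex.exp (↑Real.pi * Complex.I * (t : ℂ) / (N : ℂ))) (Set.Icc 0 1) := fun t ht =>
    (sectorPaths_frontier_contDiffAt N (by linarith [ht.2])).contDiffWithinAt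
  have hxY : ContDiffOn ℝ 1 (fun t : ℝ => Complex.exp (-(↑Real.pi * Complex.I / (2 * (N : ℂ)))) *
      (Complex.I * (1 - (((((2:ℝ) - t) ^ ((N:ℝ)⁻¹) : ℝ) : ℂ) *
        Complex.exp (↑Real.pi * Complex.I * (t : ℂ) / (N : ℂ))) ^ N)) ^ ((N : ℂ)⁻¹)) (Set.Icc 0 1) :=
    fun t ht => (sectorPaths_frontierY_contDiffAt hN0 ht).contDiffWithinAt
  have hxf0 : ∀ t ∈ Set.Icc (0:ℝ) 1, ((((2:ℝ) - t) ^ ((N:ℝ)⁻¹) : ℝ) : ℂ) *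
      Complex.exp (↑Real.pi * Complex.I * (t : ℂ) / (N : ℂ)) ≠ 0 := fun t ht =>
    sectorPaths_frontier_ne_zero N (by linarith [ht.2])
  /- the five raw parametrisations -/
  obtain ⟨E2, hE2⟩ : ∃ E : ℝ → Fin 2 → ℂ, E = fun t => ![(γ.toFun (t / 2) 0)⁻¹,
      Complex.exp (-(↑Real.pi * Complex.I / (N : ℂ))) * γ.toFun (t / 2) 1 / γ.toFun (t / 2) 0] :=
    ⟨_, rfl⟩
  obtain ⟨Ff, hFf⟩ : ∃ E : ℝ → Fin 2 → ℂ, E = fun t =>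
      ![((((2:ℝ) - t) ^ ((N:ℝ)⁻¹) : ℝ) : ℂ) * Complex.exp (↑Real.pi * Complex.I * (t : ℂ) / (N : ℂ)),
        Complex.exp (-(↑Real.pi * Complex.I / (2 * (N : ℂ)))) *
          (Complex.I * (1 - (((((2:ℝ) - t) ^ ((N:ℝ)⁻¹) : ℝ) : ℂ) *
            Complex.exp (↑Real.pi * Complex.I * (t : ℂ) / (N : ℂ))) ^ N)) ^ ((N : ℂ)⁻¹)] := ⟨_, rfl⟩
  obtain ⟨E3, hE3⟩ : ∃ E : ℝ → Fin 2 → ℂ, E = fun t =>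
      ![Complex.exp (↑Real.pi * Complex.I / (N : ℂ)) * γ.toFun ((1 + t) / 2) 0 / γ.toFun ((1 + t) / 2) 1,
        (γ.toFun ((1 + t) / 2) 1)⁻¹] := ⟨_, rfl⟩
  obtain ⟨D3, hD3⟩ : ∃ E : ℝ → Fin 2 → ℂ, E = fun t =>
      ![Complex.exp (-(↑Real.pi * Complex.I / (N : ℂ))) * γ.toFun (t / 2) 1 / γ.toFun (t / 2) 0,
        (γ.toFun (t / 2) 0)⁻¹] := ⟨_, rfl⟩
  obtain ⟨FI, hFI⟩ : ∃ E : ℝ → Fin 2 → ℂ, E = fun t =>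
      ![(((((2:ℝ) - t) ^ ((N:ℝ)⁻¹) : ℝ) : ℂ) * Complex.exp (↑Real.pi * Complex.I * (t : ℂ) / (N : ℂ)))⁻¹,
        Complex.exp (↑Real.pi * Complex.I / (N : ℂ)) *
          (Complex.exp (-(↑Real.pi * Complex.I / (2 * (N : ℂ)))) *
            (Complex.I * (1 - (((((2:ℝ) - t) ^ ((N:ℝ)⁻¹) : ℝ) : ℂ) *
              Complex.exp (↑Real.pi * Complex.I * (t : ℂ) / (N : ℂ))) ^ N)) ^ ((N : ℂ)⁻¹)) /
          (((((2:ℝ) - t) ^ ((N:ℝ)⁻¹) : ℝ) : ℂ) * Complex.exp (↑Real.pi * Complex.I * (t : ℂ) / (N : ℂ)))] :=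
    ⟨_, rfl⟩
  /- their end points -/
  have h11 : ((1:ℝ) + 1) / 2 = 1 := by norm_num
  have vE2_0 : E2 0 = ![(1:ℂ), 0] := by
    simp only [hE2, zero_div, hγ0]
    simp
  have vE2_1 : E2 1 = ![(((2:ℝ) ^ ((N:ℝ)⁻¹) : ℝ) : ℂ), Complex.exp (-(↑Real.pi * Complex.I / (N : ℂ)))] := by
    simp only [hE2, hγh]
    simp [hρ]
  have vFf_0 : Ff 0 = ![(((2:ℝ) ^ ((N:ℝ)⁻¹) : ℝ) : ℂ), Complex.exp (-(↑Real.pi * Complex.I / (N : ℂ)))] := by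
    rw [hFf]
    beta_reduce
    rw [sectorPaths_frontier_zero, sectorPaths_Y_root hN0]
  have vFf_1 : Ff 1 = ![Complex.exp (↑Real.pi * Complex.I / (N : ℂ)), (((2:ℝ) ^ ((N:ℝ)⁻¹) : ℝ) : ℂ)] := by
    rw [hFf]
    beta_reduce
    rw [sectorPaths_frontier_one, sectorPaths_Y_eps hN0]
  have vE3_0 : E3 0 = ![Complex.exp (↑Real.pi * Complex.I / (N : ℂ)), (((2:ℝ) ^ ((N:ℝ)⁻¹) : ℝ) : ℂ)] := by
    simp only [hE3, add_zero, hγh]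
    simp [hρ]
  have vE3_1 : E3 1 = ![(0:ℂ), 1] := by
    simp only [hE3, h11, hγ1]
    simp
  have vD3_0 : D3 0 = ![(0:ℂ), 1] := by
    simp only [hD3, zero_div, hγ0]
    simp
  have vD3_1 : D3 1 = ![Complex.exp (-(↑Real.pi * Complex.I / (N : ℂ))), (((2:ℝ) ^ ((N:ℝ)⁻¹) : ℝ) : ℂ)] := by
    simp only [hD3, hγh]
    simp [hρ]
  have vFI_0 : FI 0 = ![((((2:ℝ) ^ ((N:ℝ)⁻¹) : ℝ) : ℂ))⁻¹, ((((2:ℝ) ^ ((N:ℝ)⁻¹) : ℝ) : ℂ))⁻¹] := by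
    rw [hFI]
    beta_reduce
    rw [sectorPaths_frontier_zero, sectorPaths_Y_root hN0, sectorChart_eps_mul_epsBar, one_div]
  have vFI_1 : FI 1 = ![Complex.exp (-(↑Real.pi * Complex.I / (N : ℂ))), (((2:ℝ) ^ ((N:ℝ)⁻¹) : ℝ) : ℂ)] := by
    rw [hFI]
    beta_reduce
    rw [sectorPaths_frontier_one, sectorPaths_Y_eps hN0, ← Complex.exp_neg, mul_div_cancel_left₀ _ hε]
  /- `C¹` on `[0,1]` -/
  have cE2 : ContDiffOn ℝ 1 E2 (Set.Icc 0 1) := by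
    rw [hE2]
    refine contDiffOn_pi.2 fun i => ?_
    fin_cases i
    · exact hG1_0.fun_inv hne1
    · exact sectorPaths_contDiffOn_div (contDiffOn_const.mul hG1_1) hG1_0 hne1
  have cFf : ContDiffOn ℝ 1 Ff (Set.Icc 0 1) := by
    rw [hFf]
    refine contDiffOn_pi.2 fun i => ?_
    fin_cases i
    · exact hxf
    · exact hxY
  have cE3 : ContDiffOn ℝ 1 E3 (Set.Icc 0 1) := by
    rw [hE3]
    refine contDiffOn_pi.2 fun i => ?_
    fin_cases i
    · exact sectorPaths_contDiffOn_div (contDiffOn_const.mul hG2_0) hG2_1 hne2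
    · exact hG2_1.fun_inv hne2
  have cD3 : ContDiffOn ℝ 1 D3 (Set.Icc 0 1) := by
    rw [hD3]
    refine contDiffOn_pi.2 fun i => ?_
    fin_cases i
    · exact sectorPaths_contDiffOn_div (contDiffOn_const.mul hG1_1) hG1_0 hne1
    · exact hG1_0.fun_inv hne1
  have cFI : ContDiffOn ℝ 1 FI (Set.Icc 0 1) := by
    rw [hFI]
    refine contDiffOn_pi.2 fun i => ?_
    fin_cases i
    · exact hxf.fun_inv hxf0
    · exact sectorPaths_contDiffOn_div (contDiffOn_const.mul hxY) hxf hxf0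
  /- on the curve -/
  have mE2 : ∀ t ∈ Set.Icc (0:ℝ) 1, E2 t ∈ (⟨2, 1, ![X 0 ^ N + X 1 ^ N - 1]⟩ : CurveData).points := by
    intro t ht
    rw [hE2, mem_points_fermat_iff]
    exact sectorPaths_inv_pow_add (hne1 t ht) (hmem (t / 2) (hI1 ht)) (sectorChart_epsBar_pow hN0)
  have mFf : ∀ t ∈ Set.Icc (0:ℝ) 1, Ff t ∈ (⟨2, 1, ![X 0 ^ N + X 1 ^ N - 1]⟩ : CurveData).points :=
    fun t _ => by
    rw [hFf]
    exact sectorChart_mem_points hN0 _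
  have mE3 : ∀ t ∈ Set.Icc (0:ℝ) 1, E3 t ∈ (⟨2, 1, ![X 0 ^ N + X 1 ^ N - 1]⟩ : CurveData).points := by
    intro t ht
    rw [hE3, mem_points_fermat_iff, add_comm]
    exact sectorPaths_inv_pow_add (hne2 t ht) (by rw [add_comm]; exact hmem ((1 + t) / 2) (hI2 ht))
      (sectorChart_eps_pow hN0)
  have mD3 : ∀ t ∈ Set.Icc (0:ℝ) 1, D3 t ∈ (⟨2, 1, ![X 0 ^ N + X 1 ^ N - 1]⟩ : CurveData).points := by
    intro t ht
    rw [hD3, mem_points_fermat_iff, add_comm]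
    exact sectorPaths_inv_pow_add (hne1 t ht) (hmem (t / 2) (hI1 ht)) (sectorChart_epsBar_pow hN0)
  have mFI : ∀ t ∈ Set.Icc (0:ℝ) 1, FI t ∈ (⟨2, 1, ![X 0 ^ N + X 1 ^ N - 1]⟩ : CurveData).points := by
    intro t ht
    rw [hFI, mem_points_fermat_iff]
    exact sectorPaths_inv_pow_add (hxf0 t ht) (by rw [sectorChart_pow hN0]; ring)
      (sectorChart_eps_pow hN0)
  /- assembly -/
  refine ⟨⟨E2, cE2, mE2, sectorPaths_algebraic_vec vE2_0 isAlgebraic_one isAlgebraic_zero,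
      sectorPaths_algebraic_vec vE2_1 hρa hε'a⟩,
    ⟨Ff, cFf, mFf, sectorPaths_algebraic_vec vFf_0 hρa hε'a, sectorPaths_algebraic_vec vFf_1 hεa hρa⟩,
    ⟨E3, cE3, mE3, sectorPaths_algebraic_vec vE3_0 hεa hρa,
      sectorPaths_algebraic_vec vE3_1 isAlgebraic_zero isAlgebraic_one⟩,
    ⟨D3, cD3, mD3, sectorPaths_algebraic_vec vD3_0 isAlgebraic_zero isAlgebraic_one,
      sectorPaths_algebraic_vec vD3_1 hε'a hρa⟩,
    ⟨FI, cFI, mFI, sectorPaths_algebraic_vec vFI_0 hρa.inv hρa.inv,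
      sectorPaths_algebraic_vec vFI_1 hε'a hρa⟩,
    ⟨fun t => γ.toFun (t / 2), hG1, fun t ht => γ.mem_points _ (hI1 ht), ?_,
      sectorPaths_algebraic_vec hγh hρa.inv hρa.inv⟩,
    ⟨fun t => γ.toFun ((1 + t) / 2), hG2, fun t ht => γ.mem_points _ (hI2 ht), ?_, ?_⟩,
    fun t => by dsimp only; rw [hE2], fun t => by dsimp only; rw [hFf], fun t => by dsimp only; rw [hE3],
    fun t => by dsimp only; rw [hD3], fun t => by dsimp only; rw [hFI], fun _ => rfl, fun _ => rfl,
    by dsimp only; rw [vE2_0, hγ0], by dsimp only; rw [vE2_1, vFf_0], by dsimp only; rw [vFf_1, vE3_0],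
    by dsimp only; rw [vE3_1, hγ1], by dsimp only; rw [vD3_0, hγ1], by dsimp only; rw [vD3_1, vFI_1],
    by dsimp only; rw [vFI_0, hγh]⟩
  · intro i
    simp only [zero_div]
    exact γ.algebraic_zero i
  · intro i
    simp only [add_zero]
    exact sectorPaths_algebraic_vec hγh hρa.inv hρa.inv i
  · intro i
    simp only [h11]
    exact γ.algebraic_one i

end Summit.KontsevichZagierPeriods.FermatIsogeny.BetaLinearSector

end
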